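import Literature.Geometry.Lorentzian.TranslationalKIDImmersion
import Literature.Geometry.Lorentzian.InitialDataPullback
import Literature.Geometry.Lorentzian.CauchyDevelopmentComap
import Literature.Geometry.Lorentzian.HypersurfaceRestriction
import HarnessLib

/-!
# Translational KIDs on an abstract `3`-manifold integrate to local immersions into Minkowski
# space-time

The chart-level theorem `InitialDataSet.exists_spacelikeImmersion_minkowski_of_kids_of_gram_at`
(`TranslationalKIDImmersion.lean`) integrates four solutions `(N_a, Y_a)` of the translational
KID system of Beig–Chruściel 1996, App. A,

  `h(∇ᵤY_a, w) = −N_a k(u, w)`,  `dN_a(u) = −k(u, Y_a)`,  `−N_a N_b + h(Y_a, Y_b) = η_{ab}`,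

on a star-shaped chart domain `U ⊆ ℝ³` to a spacelike immersion `f : U → (ℝ⁴, η)` with
`f^*η = h`, `K_ν = k`. Here the same statement is transported to an ABSTRACT `3`-manifold `X`
(data `(h, k)` and KIDs given globally on `X`, Gram matrix `η` and `N₀ > 0` at a point `x₀`):
`x₀` has a neighbourhood `V` immersed into Minkowski space-time with induced metric `h` and second
fundamental form `k` — the local isometric embeddings of the proof of the rigid positive energy
theorem (Beig–Chruściel, J. Math. Phys. 37 (1996), Thm. 4.1, §4), chart by chart. The transport
uses the diffeomorphism covariance of the data (`InitialDataSet.comap`, `InitialDataPullback.lean`),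
of the Levi-Civita connection (`leviCivita_comap_mpullback_apply`, `ConnectionNaturality.lean`)
and of the shape tensor (`secondFundamentalForm_comp_right`, `CauchyDevelopmentComap.lean`):

* `InitialDataSet.kid_shift_comap`, `kid_lapse_comap`, `kidPairing_comap`,
  `contMDiff_mpullback_of_injective` — along an equidimensional immersion `Φ : N → M` the
  pulled-back lapses/shifts `(N_a ∘ Φ, Φ^*Y_a)` satisfy, for the pulled-back data `Φ^* D`, the
  shift equation, the lapse equation and the Gram identities that `(N_a, Y_a)` satisfy for `D`
  (any dimension, any model);
* `InitialDataSet.exists_local_minkowski_immersion_of_kids` — **main result**: KIDs on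
  `(X³, h, k)` everywhere, Gram `η` and `N₀ > 0` at `x₀` ⟹ an open `V ∋ x₀`, a smooth spacelike
  immersion `f : V → ℝ⁴` with future unit normal `ν` (smooth lift), `df = (ε_a h(Y_a, ·))_a`,
  `ν = (−ε_a N_a)_a`, `f^*η = h` and `K_ν = k` on `V`.

Theorems only; no definitions, no named facts.

## References

* R. Beig, P. T. Chruściel, *Killing vectors in asymptotically flat space-times. I.*, J. Math.
  Phys. 37 (1996) 1939–1961, Thm. 4.1, §4 and App. A, (A.11)–(A.11.0). [BeigChrusciel1996]
* R. Bartnik, J. Isenberg, *The constraint equations* (2004), §2 (diffeomorphism covariance).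
  [BartnikIsenberg2004]
* B. O'Neill, *Semi-Riemannian geometry*, Academic Press 1983, Ch. 3, Prop. 3.59–Cor. 3.61; Ch. 4,
  Lemma 4.4. [ONeill1983]
-/

noncomputable section

open Bundle Set Function Manifold VectorField
open scoped Manifold ContDiff Topology

namespace Literature.Geometry.Lorentzian

/-! ### Transport of KIDs along a local diffeomorphism -/

namespace InitialDataSet

section Comap

variable {E : Type*} [NormedAddCommGroup E] [NormedSpace ℝ E] {H : Type*} [TopologicalSpace H]
  {I : ModelWithCorners ℝ E H} {M : Type*} [TopologicalSpace M] [ChartedSpace H M]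
  [IsManifold I ∞ M]
  {E' : Type*} [NormedAddCommGroup E'] [NormedSpace ℝ E'] {H' : Type*} [TopologicalSpace H']
  {I' : ModelWithCorners ℝ E' H'} {N : Type*} [TopologicalSpace N] [ChartedSpace H' N]
  [IsManifold I' ∞ N] [FiniteDimensional ℝ E] [FiniteDimensional ℝ E']
  (D : InitialDataSet I M) {Φ : N → M} (hΦ : ContMDiff I' I (∞ + 1) Φ)
  (hΦ' : ∀ u, Function.Injective (mfderiv I' I Φ u))
  (hdim : Module.finrank ℝ E' = Module.finrank ℝ E)

include hdim in
/-- **The shift equation is natural.** For an equidimensional immersion `Φ : N → M` (a local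
diffeomorphism), the pulled-back data `Φ^* D = (Φ^* h, Φ^* k)` (`InitialDataSet.comap`), a lapse
`N_a` and a shift `Y_a` of `M` satisfying the first KID equation `h(∇ᵥY_a, w) = −N_a k(v, w)` at
`Φ u`: the pulled-back pair `(N_a ∘ Φ, Φ^* Y_a)` satisfies it at `u` for `Φ^* D`, by the
naturality of the Levi-Civita connection `∇^{Φ^*h}_v (Φ^*Y) = (dΦ)⁻¹ ∇^h_{dΦ v} Y`
(`leviCivita_comap_mpullback_apply`, O'Neill 1983, Ch. 3, Prop. 3.59). Bartnik–Isenberg 2004,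
§2 (diffeomorphism covariance of the constraint/KID operators).
[cite: ONeill1983, Ch. 3, Prop. 3.59] -/
theorem kid_shift_comap [D.metric.HasLeviCivita] [(D.comap Φ hΦ hΦ').metric.HasLeviCivita]
    {Nf : M → ℝ} {Y : Π x : M, TangentSpace I x} {u : N} (hY : MDiffAt (T% Y) (Φ u))
    (hDY : ∀ v w : TangentSpace I (Φ u),
      D.metric.val (Φ u) (D.metric.leviCivita Y (Φ u) v) w = -(Nf (Φ u) * D.k (Φ u) v w))
    (v w : TangentSpace I' u) :
    (D.comap Φ hΦ hΦ').metric.val u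
        ((D.comap Φ hΦ hΦ').metric.leviCivita (mpullback I' I Φ Y) u v) w =
      -(Nf (Φ u) * (D.comap Φ hΦ hΦ').k u v w) := by
  haveI : (D.metric.comap PseudoRiemannianMetric.contMDiff_pullbackBilin_holds Φ hΦ hΦ'
      hdim).HasLeviCivita := ‹(D.comap Φ hΦ hΦ').metric.HasLeviCivita›
  have h1 : (D.comap Φ hΦ hΦ').metric.leviCivita (mpullback I' I Φ Y) u v =
      (mfderiv I' I Φ u).inverse (D.metric.leviCivita Y (Φ u) (mfderiv I' I Φ u v)) :=
    PseudoRiemannianMetric.leviCivita_comap_mpullback_apply D.metric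
      PseudoRiemannianMetric.contMDiff_pullbackBilin_holds hΦ hΦ' hdim hY v
  have hinv : (mfderiv I' I Φ u).IsInvertible :=
    PseudoRiemannianMetric.isInvertible_mfderiv_of_injective hdim (hΦ' u)
  rw [h1, val_metric, comap_h_inner, comap_k, hinv.self_apply_inverse, ← D.val_metric, hDY]

include hdim in
/-- **The lapse equation is natural**: if `dN_a(v) = −k(v, Y_a)` at `Φ u` then
`d(N_a ∘ Φ)(v) = −(Φ^*k)(v, Φ^*Y_a)` at `u` (chain rule and `dΦ (Φ^*Y) = Y ∘ Φ`).
[cite: BartnikIsenberg2004, §2] -/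
theorem kid_lapse_comap {Nf : M → ℝ} {Y : Π x : M, TangentSpace I x} {u : N}
    (hN : MDiffAt Nf (Φ u))
    (hdN : ∀ v : TangentSpace I (Φ u), mvfderiv I Nf (Φ u) v = -(D.k (Φ u) v (Y (Φ u))))
    (v : TangentSpace I' u) :
    mvfderiv I' (Nf ∘ Φ) u v = -((D.comap Φ hΦ hΦ').k u v (mpullback I' I Φ Y u)) := by
  have hΦu : MDifferentiableAt I' I Φ u := (hΦ u).mdifferentiableAt (by simp)
  have hc : mvfderiv I' (Nf ∘ Φ) u v = mvfderiv I Nf (Φ u) (mfderiv I' I Φ u v) := by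
    show mfderiv I' 𝓘(ℝ, ℝ) (Nf ∘ Φ) u v = mfderiv I 𝓘(ℝ, ℝ) Nf (Φ u) (mfderiv I' I Φ u v)
    rw [mfderiv_comp u hN hΦu]
    rfl
  rw [hc, hdN, comap_k, PseudoRiemannianMetric.mfderiv_mpullback_apply hΦ' hdim]

include hdim in
/-- **The Gram pairings are natural**: `(Φ^*h)(Φ^*Y_a, Φ^*Y_b) − (N_a ∘ Φ)(N_b ∘ Φ)` at `u` is
`h(Y_a, Y_b) − N_a N_b` at `Φ u`. [folklore] -/
theorem kidPairing_comap (Nf : ℝ → ℝ → ℝ) {Na Nb : M → ℝ} (Y Z : Π x : M, TangentSpace I x)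
    (u : N) :
    Nf (Na (Φ u)) (Nb (Φ u)) + (D.comap Φ hΦ hΦ').h.inner u (mpullback I' I Φ Y u)
        (mpullback I' I Φ Z u) =
      Nf (Na (Φ u)) (Nb (Φ u)) + D.h.inner (Φ u) (Y (Φ u)) (Z (Φ u)) := by
  rw [comap_h_inner, PseudoRiemannianMetric.mfderiv_mpullback_apply hΦ' hdim,
    PseudoRiemannianMetric.mfderiv_mpullback_apply hΦ' hdim]

include hΦ hΦ' hdim in
/-- The pullback `Φ^* Y` of a smooth vector field along a smooth equidimensional immersion is
smooth (Mathlib's `ContMDiff.mpullback_vectorField`; the differentials are invertible).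
[folklore] -/
theorem contMDiff_mpullback_of_injective {Y : Π x : M, TangentSpace I x}
    (hY : CMDiff ∞ (T% Y)) : CMDiff ∞ (T% (mpullback I' I Φ Y)) :=
  hY.mpullback_vectorField hΦ
    (fun u ↦ PseudoRiemannianMetric.isInvertible_mfderiv_of_injective hdim (hΦ' u)) le_rfl

end Comap

/-! ### KIDs on an abstract `3`-manifold: the local immersion around every point -/

section Patch

variable {X : Type*} [TopologicalSpace X] [ChartedSpace E3 X] [IsManifold (𝓡 3) ∞ X]
  (D : InitialDataSet (𝓡 3) X) [D.metric.HasLeviCivita]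
  (N : Fin 4 → X → ℝ) (Y : Fin 4 → Π x : X, TangentSpace (𝓡 3) x)

/-- **Translational KIDs integrate, near every point of an abstract `3`-manifold, to a spacelike
immersion into Minkowski space-time inducing the data.** Let `(X, h, k)` be a `3`-dimensional
initial data set carrying smooth lapses and shifts `(N_a, Y_a)_{a<4}` which satisfy the
translational KID system `h(∇ᵤY_a, w) = −N_a k(u, w)`, `dN_a(u) = −k(u, Y_a)` everywhere, have
Minkowskian Gram matrix `−N_a N_b + h(Y_a, Y_b) = η_{ab}` at the point `x₀`, and `N₀(x₀) > 0`.
Then `x₀` has an open neighbourhood `V` with a smooth spacelike immersion `f : V → (ℝ⁴, η)` and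
future unit normal `ν` (smooth lift) such that `f^*η = h`, `K_ν = k`, `df = (ε_a h(Y_a, ·))_a`
and `ν = (−ε_a N_a)_a` on `V`. Proof: in the chart `φ` at `x₀`, on a coordinate ball `U`, the
pulled-back data `Φ^*(h, k)` (`Φ = φ⁻¹`, `InitialDataSet.comap`) carry the pulled-back KIDs
(`kid_shift_comap`, `kid_lapse_comap`, `kidPairing_comap`); the chart-level theorem
`exists_spacelikeImmersion_minkowski_of_kids_of_gram_at` (`TranslationalKIDImmersion.lean`:
Poincaré lemma on the star-shaped `U`, tetrad completeness) gives the immersion `f'` of `U`;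
and `f = f' ∘ φ` on `V = φ⁻¹(U)` has induced metric and second fundamental form `h, k` by the
chain rule and the reparametrisation naturality of the shape tensor
(`secondFundamentalForm_comp_right`). This is the construction of the local isometric embeddings
in the proof of Beig–Chruściel, J. Math. Phys. 37 (1996), Thm. 4.1 (§4, via the Killing
development of [6]) — here for abstract `Σ`, chart by chart.
[cite: BeigChrusciel1996, proof of Thm. 4.1, §4 and App. A (A.11)–(A.11.0)] -/
theorem exists_local_minkowski_immersion_of_kids
    (hN : ∀ a, ContMDiff (𝓡 3) 𝓘(ℝ, ℝ) ∞ (N a))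
    (hY : ∀ a, ContMDiff (𝓡 3) ((𝓡 3).prod (𝓡 3)) ∞
      fun x ↦ (TotalSpace.mk' E3 x (Y a x) : TangentBundle (𝓡 3) X))
    (hDY : ∀ a (x : X) (v w : TangentSpace (𝓡 3) x),
      D.metric.val x (D.metric.leviCivita (Y a) x v) w = -(N a x * D.k x v w))
    (hdN : ∀ a (x : X) (v : TangentSpace (𝓡 3) x),
      mvfderiv (𝓡 3) (N a) x v = -(D.k x v (Y a x)))
    (x₀ : X)
    (hG : ∀ a b, -(N a x₀ * N b x₀) + D.h.inner x₀ (Y a x₀) (Y b x₀) =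
      if a = b then (if a = 0 then -1 else 1) else 0)
    (hN0 : 0 < N 0 x₀) :
    ∃ V : TopologicalSpace.Opens X, x₀ ∈ V ∧ ∃ (f : V → E4) (ν : V → E4),
      Minkowski.smoothMetric.toPseudoRiemannianMetric.IsSpacelikeImmersion (𝓡 3) f ∧
      Minkowski.smoothMetric.IsFutureUnitNormal (𝓡 3) (Minkowski.timeOrientation.ofLE le_top) f ν ∧
      ContMDiff (𝓡 3) 𝓘(ℝ, E4).tangent ∞
        (fun y ↦ (TotalSpace.mk' E4 (f y) (ν y) : TangentBundle 𝓘(ℝ, E4) E4)) ∧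
      (∀ (y : V) (v : E3), mfderiv (𝓡 3) 𝓘(ℝ, E4) f y v =
        WithLp.toLp 2 fun a ↦ (if a = 0 then -1 else 1 : ℝ) * D.h.inner y.1 (Y a y.1) v) ∧
      (∀ y : V, ν y = WithLp.toLp 2 fun a ↦ -((if a = 0 then -1 else 1 : ℝ) * N a y.1)) ∧
      (∀ (y : V) (v w : E3),
        Minkowski.smoothMetric.toPseudoRiemannianMetric.inducedBilin (𝓡 3) f y v w =
          D.h.inner y.1 v w) ∧
      ∀ [Minkowski.smoothMetric.toPseudoRiemannianMetric.HasLeviCivita] (y : V) (v w : E3),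
        Minkowski.smoothMetric.toPseudoRiemannianMetric.secondFundamentalForm (𝓡 3) f ν y v w =
          D.k y.1 v w := by
  -- the chart at `x₀` and a coordinate ball `U` inside its target
  set φ := chartAt E3 x₀ with hφ_def
  have hx₀ : x₀ ∈ φ.source := mem_chart_source E3 x₀
  obtain ⟨r, hr, hball⟩ := Metric.mem_nhds_iff.mp (φ.open_target.mem_nhds (φ.map_source hx₀))
  set U : TopologicalSpace.Opens E3 := ⟨Metric.ball (φ x₀) r, Metric.isOpen_ball⟩ with hU_def
  have hz₀ : φ x₀ ∈ U := Metric.mem_ball_self hr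
  have hUc : StarConvex ℝ (φ x₀) (U : Set E3) := (convex_ball (φ x₀) r).starConvex hz₀
  -- the inverse chart `Ψ : U → X`, an equidimensional immersion
  set Ψ : U → X := fun z ↦ φ.symm z with hΨ_def
  have hφd : φ.MDifferentiable (𝓡 3) (𝓡 3) := mdifferentiable_chart x₀
  have hΨs' : ContMDiff 𝓘(ℝ, E3) (𝓡 3) ∞ Ψ :=
    contMDiffOn_chart_symm.comp_contMDiff contMDiff_subtype_val fun z ↦ hball z.2
  have hΨs : ContMDiff 𝓘(ℝ, E3) (𝓡 3) (∞ + 1) Ψ := hΨs'.of_le (le_of_eq rfl)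
  have hΨd : ∀ z : U, mfderiv 𝓘(ℝ, E3) (𝓡 3) Ψ z = mfderiv 𝓘(ℝ, E3) (𝓡 3) φ.symm z.1 :=
    fun z ↦ mfderiv_comp_subtypeVal (hφd.symm.mdifferentiableAt (hball z.2))
  have hΨ' : ∀ z : U, Function.Injective (mfderiv 𝓘(ℝ, E3) (𝓡 3) Ψ z) := fun z ↦ by
    rw [hΨd z]
    exact hφd.symm.mfderiv_injective (hball z.2)
  have hdim : Module.finrank ℝ E3 = Module.finrank ℝ E3 := rfl
  haveI : (D.comap Ψ hΨs hΨ').metric.HasLeviCivita := (D.comap Ψ hΨs hΨ').metric.hasLeviCivita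
  -- the transported KIDs on `U`
  have hN' : ∀ a, ContMDiff 𝓘(ℝ, E3) 𝓘(ℝ, ℝ) ∞ (fun z : U ↦ N a (Ψ z)) := fun a ↦
    (hN a).comp hΨs'
  have hY' : ∀ a, ContMDiff 𝓘(ℝ, E3) (𝓘(ℝ, E3).prod 𝓘(ℝ, E3)) ∞
      (fun z : U ↦ (TotalSpace.mk' E3 z (mpullback 𝓘(ℝ, E3) (𝓡 3) Ψ (Y a) z) :
        TangentBundle 𝓘(ℝ, E3) U)) := fun a ↦
    contMDiff_mpullback_of_injective hΨs hΨ' hdim (hY a)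
  have hDY' : ∀ a (z : U) (v w : E3), (D.comap Ψ hΨs hΨ').metric.val z
      ((D.comap Ψ hΨs hΨ').metric.leviCivita (mpullback 𝓘(ℝ, E3) (𝓡 3) Ψ (Y a)) z v) w =
        -(N a (Ψ z) * (D.comap Ψ hΨs hΨ').k z v w) := fun a z v w ↦
    D.kid_shift_comap hΨs hΨ' hdim ((hY a _).mdifferentiableAt (by simp)) (hDY a (Ψ z)) v w
  have hdN' : ∀ a (z : U) (v : E3), mvfderiv 𝓘(ℝ, E3) (fun z : U ↦ N a (Ψ z)) z v =
      -((D.comap Ψ hΨs hΨ').k z v (mpullback 𝓘(ℝ, E3) (𝓡 3) Ψ (Y a) z)) := fun a z v ↦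
    D.kid_lapse_comap hΨs hΨ' hdim ((hN a _).mdifferentiableAt (by simp)) (hdN a (Ψ z)) v
  have hΨz₀ : Ψ ⟨φ x₀, hz₀⟩ = x₀ := φ.left_inv hx₀
  have hG' : ∀ a b, -(N a (Ψ ⟨φ x₀, hz₀⟩) * N b (Ψ ⟨φ x₀, hz₀⟩)) +
      (D.comap Ψ hΨs hΨ').h.inner ⟨φ x₀, hz₀⟩ (mpullback 𝓘(ℝ, E3) (𝓡 3) Ψ (Y a) ⟨φ x₀, hz₀⟩)
        (mpullback 𝓘(ℝ, E3) (𝓡 3) Ψ (Y b) ⟨φ x₀, hz₀⟩) =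
      if a = b then (if a = 0 then -1 else 1) else 0 := fun a b ↦ by
    rw [D.kidPairing_comap hΨs hΨ' hdim (fun p q ↦ -(p * q)) (Na := N a) (Nb := N b) (Y a) (Y b)
      ⟨φ x₀, hz₀⟩, hΨz₀]
    exact hG a b
  have hN0' : 0 < N 0 (Ψ ⟨φ x₀, hz₀⟩) := by rw [hΨz₀]; exact hN0
  -- the immersion of the coordinate ball
  obtain ⟨f', ν', hfi, hun, hlift, hdf, hν, hind, hK⟩ :=
    (D.comap Ψ hΨs hΨ').exists_spacelikeImmersion_minkowski_of_kids_of_gram_at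
      (fun a z ↦ N a (Ψ z)) (fun a ↦ mpullback 𝓘(ℝ, E3) (𝓡 3) Ψ (Y a)) hz₀ hUc hN' hY' hDY'
      hdN' hG' hN0'
  -- back to `X`: `V = φ⁻¹(U)`, `χ = φ|_V : V → U`, `f = f' ∘ χ`
  set V : TopologicalSpace.Opens X :=
    ⟨φ.source ∩ φ ⁻¹' Metric.ball (φ x₀) r, φ.isOpen_inter_preimage Metric.isOpen_ball⟩ with hV_def
  have hxV : x₀ ∈ V := ⟨hx₀, Metric.mem_ball_self hr⟩
  set χ : V → U := fun y ↦ ⟨φ y, y.2.2⟩ with hχ_def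
  have hχs : ContMDiff (𝓡 3) 𝓘(ℝ, E3) ∞ χ :=
    (ContMDiff.subtypeVal_comp_iff U χ).mp
      ((contMDiffOn_chart (x := x₀)).comp_contMDiff contMDiff_subtype_val fun y ↦ y.2.1)
  have hχd' : ∀ y : V, MDifferentiableAt (𝓡 3) 𝓘(ℝ, E3) χ y := fun y ↦
    (hχs y).mdifferentiableAt (by simp)
  have hΨχ : ∀ y : V, Ψ (χ y) = y.1 := fun y ↦ φ.left_inv y.2.1
  have hχd : ∀ y : V, mfderiv (𝓡 3) 𝓘(ℝ, E3) χ y = mfderiv (𝓡 3) 𝓘(ℝ, E3) φ y.1 := by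
    intro y
    have h1 : mfderiv (𝓡 3) 𝓘(ℝ, E3) (Subtype.val ∘ χ) y =
        (mfderiv 𝓘(ℝ, E3) 𝓘(ℝ, E3) (Subtype.val : U → E3) (χ y)).comp
          (mfderiv (𝓡 3) 𝓘(ℝ, E3) χ y) :=
      mfderiv_comp y ((contMDiff_subtype_val (n := ∞)).mdifferentiableAt (by simp)) (hχd' y)
    have h2 : mfderiv (𝓡 3) 𝓘(ℝ, E3) (Subtype.val ∘ χ) y = mfderiv (𝓡 3) 𝓘(ℝ, E3) φ y.1 :=
      mfderiv_comp_subtypeVal (hφd.mdifferentiableAt y.2.1)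
    rw [mfderiv_subtypeVal, h2] at h1
    rw [h1]
    ext v
    rfl
  have hcomp : ∀ (y : V) (v : E3),
      mfderiv 𝓘(ℝ, E3) (𝓡 3) Ψ (χ y) (mfderiv (𝓡 3) 𝓘(ℝ, E3) χ y v) = v := by
    intro y v
    rw [hΨd, hχd]
    exact congrArg (fun L : E3 →L[ℝ] E3 ↦ L v) (hφd.symm_comp_deriv y.2.1)
  have hff : ∀ y : V, MDifferentiableAt 𝓘(ℝ, E3) 𝓘(ℝ, E4) f' (χ y) := fun y ↦
    (hfi.contMDiff_self _).mdifferentiableAt (by simp)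
  have hdfy : ∀ (y : V) (v : E3), mfderiv (𝓡 3) 𝓘(ℝ, E4) (fun y ↦ f' (χ y)) y v =
      mfderiv 𝓘(ℝ, E3) 𝓘(ℝ, E4) f' (χ y) (mfderiv (𝓡 3) 𝓘(ℝ, E3) χ y v) := by
    intro y v
    rw [show (fun y ↦ f' (χ y)) = f' ∘ χ from rfl, mfderiv_comp y (hff y) (hχd' y)]
    rfl
  -- the transported induced metric and second fundamental form
  have hind' : ∀ (y : V) (v w : E3),
      Minkowski.smoothMetric.toPseudoRiemannianMetric.inducedBilin (𝓡 3) (fun y ↦ f' (χ y)) y v w =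
        D.h.inner y.1 v w := by
    intro y v w
    rw [PseudoRiemannianMetric.inducedBilin_apply, hdfy, hdfy,
      ← PseudoRiemannianMetric.inducedBilin_apply, hind, comap_h_inner, hcomp, hcomp, hΨχ]
  refine ⟨V, hxV, fun y ↦ f' (χ y), fun y ↦ ν' (χ y), ⟨hfi.1.comp (hχs.of_le (le_of_eq rfl)),
    fun y v hv ↦ ?_⟩, ⟨⟨fun y v ↦ ?_, fun y ↦ hun.1.2 (χ y)⟩, fun y ↦ hun.2 (χ y)⟩,
    hlift.comp hχs, fun y v ↦ ?_, fun y ↦ ?_, hind', ?_⟩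
  · -- spacelike
    rw [hind' y v v]
    exact D.h.pos y.1 v hv
  · -- normal
    show Minkowski.bilin (ν' (χ y)) (mfderiv (𝓡 3) 𝓘(ℝ, E4) (fun y ↦ f' (χ y)) y v) = 0
    rw [hdfy]
    exact hun.1.1 (χ y) _
  · -- `df = (ε_a h(Y_a, ·))_a`
    rw [hdfy, hdf]
    congr 1
    funext a
    rw [comap_h_inner, PseudoRiemannianMetric.mfderiv_mpullback_apply hΨ' hdim, hcomp, hΨχ]
  · -- `ν = (−ε_a N_a)_a`
    show ν' (χ y) = _
    rw [hν, hΨχ]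
  · -- second fundamental form
    intro inst y v w
    show PseudoRiemannianMetric.secondFundamentalForm (𝓡 3)
      Minkowski.smoothMetric.toPseudoRiemannianMetric (f' ∘ χ) (fun u ↦ ν' (χ u)) y v w = _
    rw [PseudoRiemannianMetric.secondFundamentalForm_comp_right
      (g := Minkowski.smoothMetric.toPseudoRiemannianMetric) (f := f') (ν := ν') (Ψ := χ)
      (u := y) BoundarylessManifold.isInteriorPoint BoundarylessManifold.isInteriorPoint
      ((hlift (χ y)).mdifferentiableAt (by simp)) (hχd' y) v w, hK (χ y), kBilin_apply, comap_k,
      hcomp, hcomp, hΨχ]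

end Patch

end InitialDataSet

end Literature.Geometry.Lorentzian

end
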